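import Summits.AtomisticToContinuum.FouriersLaw.Theses.HeatModeWeylLaw
import Summits.AtomisticToContinuum.FouriersLaw.Theorems.HeatModeWeylLawSpecificHeatLimitPinned
import Summits.AtomisticToContinuum.FouriersLaw.Theorems.HeatModeWeylLawSpecificHeatLimitIdentities
import Summits.AtomisticToContinuum.FouriersLaw.Theorems.HeatModeWeylLawSpecificHeatLimitMoments
import Summits.AtomisticToContinuum.FouriersLaw.Theorems.HeatModeWeylLawSpecificHeatLimitCovariancePackage
import Summits.AtomisticToContinuum.FouriersLaw.Theorems.HeatModeWeylLawSpecificHeatLimitCesaro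
import Summits.AtomisticToContinuum.FouriersLaw.Theorems.HeatModeWeylLawSpecificHeatLimitAssembly
import Summits.AtomisticToContinuum.FouriersLaw.Theorems.JunctionLocalityInsertionGibbsProduct
import Literature.Analysis.OperatorTheory.PositiveKernelTransferOperator
import Literature.Analysis.OperatorTheory.PositivityImprovingSpectralGap
import Literature.Probability.Distributions.GaussianMoments
import Mathlib.Probability.Moments.Variance
import Mathlib.Analysis.SpecificLimits.Basic
import HarnessLib

/-!
# The specific heat per site of the pinned anharmonic chain exists and is positive
# (`SpecificHeatLimit`, route `HeatModeWeylLaw` of `AtomisticToContinuum/FouriersLaw`) — PROVED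

Closes item `stmt-AtomisticToContinuum-12398`: for `P = pinnedChain ω₂ lam β γ` (all four parameters
`> 0`) and `T > 0` there is `c_v > 0` with `Var_{μ_N}(H_N)/(N T²) → c_v`, `μ_N = P.gibbsMeasure N T`
(`specificHeatLimit_proof`).

Proof. (1) `confVariance_div_tendsto`: with `ν_n = Z⁻¹ e^{-Φ_{n+1}/T} dq` the configurational Gibbs
probability measure of the `(n+1)`-site chain, `Var_{ν_n}(Φ_{n+1})/(n+1) → σ² ≥ 0` — the symmetrised
transfer operator `A` of the kernel `a(q) e^{-V(q'-q)/T} a(q')` (`a = e^{-U/4T}`) on `L²(a² dq)` is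
compact, self-adjoint and positivity improving (`Literature.Analysis.OperatorTheory.exists_transferOperator`),
hence has a simple top eigenvalue with a gap (`IsPositivityImproving.exists_norm_pow_sub_le`,
Jentzsch / Kreĭn–Rutman); the Gibbs moments of the bond energies are matrix elements of words in
`A, H₁, H₂` (`gibbsMoments_eq_inner`), their covariances decay exponentially and converge in the bulk
(`exists_covariance_bounds`), the Cesàro lemma `tendsto_sum_sum_div` gives the limit of
`Var(∑ hᵢ)/n`, and the boundary term is controlled by `abs_variance_potential_sub_sum_cov_le` /
`boundary_ratio_le`. (2) `integral_sq_sub_hamiltonian_eq`: under the Gibbs state the momenta are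
i.i.d. `𝒩(0, T)` independent of the positions (`gibbsMeasure_eq_prod`), so
`Var(H_N) = N T²/2 + Var_{ν}(Φ_N)` (`variance_add_prod`, `variance_sum_pi`, Gaussian moments).
(3) Hence `c_v = 1/2 + σ²/T² ≥ 1/2 > 0`. [folklore]
-/

noncomputable section

open MeasureTheory ProbabilityTheory Set Filter Topology Function
open scoped RealInnerProductSpace ENNReal NNReal

namespace Summit.AtomisticToContinuum.FouriersLaw.Theorems

open Literature.MathematicalPhysics.KineticTheory.HeatConduction Literature.Analysis.OperatorTheory
open Literature.Probability.Distributions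
open Summit.AtomisticToContinuum.FouriersLaw.Cruxes.SuperadditiveResistance.InsertionToolbox

namespace SpecificHeatLimit

/-- **The configurational energy variance per site converges.** For the pinned anharmonic chain
(`ω₂ > 0`, `lam, β ≥ 0`) at `T > 0`, with `ν_n` the configurational Gibbs probability measure
`Z⁻¹ e^{-Φ_{n+1}/T} dq` of the `(n+1)`-site chain: `Var_{ν_n}(Φ_{n+1})/(n+1) → σ²` for some `σ² ≥ 0`.
[folklore] -/
theorem confVariance_div_tendsto {ω₂ lam β : ℝ} (hω : 0 < ω₂) (hl : 0 ≤ lam) (hβ : 0 ≤ β) (γ : ℝ)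
    {T : ℝ} (hT : 0 < T) :
    ∃ σ2 : ℝ, 0 ≤ σ2 ∧ Tendsto (fun n : ℕ =>
      Var[(pinnedChain ω₂ lam β γ).potential (n + 1);
        (ENNReal.ofReal (∫ q : Fin (n + 1) → ℝ,
            Real.exp (-(pinnedChain ω₂ lam β γ).potential (n + 1) q / T)))⁻¹ •
          volume.withDensity fun q =>
            ENNReal.ofReal (Real.exp (-(pinnedChain ω₂ lam β γ).potential (n + 1) q / T))] /
        ((n : ℝ) + 1)) atTop (𝓝 σ2) := by
  set P := pinnedChain ω₂ lam β γ with hP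
  -- ### the objects `a, k, h, ρ`
  set a : ℝ → ℝ := fun x => Real.exp (-P.U x / (4 * T)) with hadef
  have ha : ∀ x, a x = Real.exp (-P.U x / (4 * T)) := fun x => rfl
  set k : ℝ → ℝ → ℝ := fun x y => a x * Real.exp (-P.V (y - x) / T) * a y with hkdef
  have hk : ∀ x y, k x y = a x * Real.exp (-P.V (y - x) / T) * a y := fun x y => rfl
  set h : ℝ → ℝ → ℝ := fun x y => (P.U x + P.U y) / 2 + P.V (y - x) with hhdef
  have hh : ∀ x y, h x y = (P.U x + P.U y) / 2 + P.V (y - x) := fun x y => rfl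
  set ρ : Measure ℝ := volume.withDensity fun x => ENNReal.ofReal (a x ^ 2) with hρdef
  have hρ : ρ = volume.withDensity fun x => ENNReal.ofReal (a x ^ 2) := rfl
  haveI : IsFiniteMeasure ρ := isFiniteMeasure_siteMeasure (β := β) (γ := γ) hω hl hT ha hρ
  have hρ0 : ρ ≠ 0 := siteMeasure_ne_zero (β := β) (γ := γ) hω hl hT ha hρ
  have hU0 : ∀ x, 0 ≤ P.U x := pinnedChain_U_nonneg hω.le hl γ
  have hV0 : ∀ r, 0 ≤ P.V r := pinnedChain_V_nonneg hβ γ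
  have hUc : Continuous P.U := pinnedChain_continuous_U γ
  have hVc : Continuous P.V := pinnedChain_continuous_V γ
  have hint : Integrable fun x => a x ^ 2 := integrable_siteWeight_sq (β := β) (γ := γ) hω hl hT ha
  obtain ⟨-, ham, hapos, -, hab, hUab⟩ := siteWeight_props (β := β) (γ := γ) hω.le hl hT ha
  obtain ⟨hkc, hksymm, hkpos, -, hkb⟩ := transferKernel_props hω.le hl hβ hT ha hk
  obtain ⟨hkhm, hkhb, hkh2m, hkh2b, hkhsymm, -⟩ := insertionKernel_bounds hω.le hl hβ hT ha hk hh
  -- ### the operators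
  obtain ⟨A, hA, hsa, hcomp, himp, hA0⟩ :=
    exists_transferOperator (μ := ρ) hkc.stronglyMeasurable hkb hksymm hkpos hρ0
  obtain ⟨H₁, hH₁⟩ := exists_kernelOp (μ := ρ) hkhm.stronglyMeasurable hkhb
  obtain ⟨H₂, hH₂⟩ := exists_kernelOp (μ := ρ) hkh2m.stronglyMeasurable hkh2b
  have hH₁sa : IsSelfAdjoint H₁ := isSelfAdjoint_kernelOp hkhm.stronglyMeasurable hkhb hkhsymm hH₁
  have hsymA : ∀ x y, ⟪A x, y⟫ = ⟪x, A y⟫ := fun x y => hsa.isSymmetric x y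
  have hsymH : ∀ x y, ⟪H₁ x, y⟫ = ⟪x, H₁ y⟫ := fun x y => hH₁sa.isSymmetric x y
  -- a common bound for the kernels and the boundary functions
  set C : ℝ := 1 + 5 * T + 108 * T ^ 2 + 64 * T ^ 2 with hC
  have hkbC : ∀ x y, ‖k x y‖ ≤ C := fun x y => (hkb x y).trans (by rw [hC]; nlinarith [sq_nonneg T])
  have hkhbC : ∀ x y, ‖k x y * h x y‖ ≤ C := fun x y =>
    (hkhb x y).trans (by rw [hC]; nlinarith [sq_nonneg T])
  have hkh2bC : ∀ x y, ‖k x y * h x y ^ 2‖ ≤ C := fun x y =>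
    (hkh2b x y).trans (by rw [hC]; nlinarith [sq_nonneg T])
  have hUabC : ∀ x, ‖P.U x ^ 2 * a x‖ ≤ C := fun x => (hUab x).trans (by rw [hC]; nlinarith [sq_nonneg T])
  -- ### boundary vectors
  set b : Lp ℝ 2 ρ := (memLp_two_of_bound (μ := ρ) ham hab).toLp a with hbdef
  have hUam : Measurable fun x => P.U x ^ 2 * a x := (hUc.measurable.pow_const 2).mul ham
  set bU : Lp ℝ 2 ρ := (memLp_two_of_bound (μ := ρ) hUam hUabC).toLp _ with hbUdef
  have hb : (b : ℝ → ℝ) =ᵐ[ρ] a := (memLp_two_of_bound (μ := ρ) ham hab).coeFn_toLp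
  have hbU : (bU : ℝ → ℝ) =ᵐ[ρ] fun x => P.U x ^ 2 * a x :=
    (memLp_two_of_bound (μ := ρ) hUam hUabC).coeFn_toLp
  -- ### the identities
  have hid := fun n => gibbsMoments_eq_inner (P := P) hT.ne' ha hUc.measurable hab hk hρ
    hkc.measurable hkbC hkhm hkhbC hkh2m hkh2bC hA hH₁ hH₂ hb hUabC hbU n
  -- ### spectral data
  obtain ⟨φ, hφ1, hφpos, hAφ, θ, hθ0, hθ, hpow⟩ := himp.exists_norm_pow_sub_le hsa hcomp hA0
  set lam : ℝ := ‖A‖ with hlamdef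
  have hlam : 0 < lam := norm_pos_iff.2 hA0
  -- positivity of `b` and of the partition functions
  have hbpos : IsStrictlyPositiveFun b := by
    unfold IsStrictlyPositiveFun
    filter_upwards [hb] with x hx
    rw [hx]; exact hapos x
  have hbP : IsPositiveFun b := hbpos.isPositiveFun hρ0
  have hc0 : 0 < ⟪φ, b⟫ := by rw [real_inner_comm]; exact inner_pos hbP hφpos
  have hAnP : ∀ n, IsPositiveFun ((A ^ n) b) := by
    intro n
    induction n with
    | zero => simpa using hbP
    | succ n ih => rw [pow_succ', mul_apply_eq_comp]; exact (himp _ ih).isPositiveFun hρ0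
  have hZpos' : ∀ n, 0 < ⟪b, (A ^ n) b⟫ := fun n =>
    calc (0 : ℝ) < ⟪(A ^ n) b, b⟫ := inner_pos (hAnP n) hbpos
      _ = ⟪b, (A ^ n) b⟫ := real_inner_comm _ _
  have hzt : Tendsto (fun n => ⟪b, (A ^ n) b⟫ / lam ^ n) atTop (𝓝 (⟪φ, b⟫ ^ 2)) :=
    tendsto_inner_pow_div hlam hθ0 hθ hpow
  obtain ⟨zs, hzs0, hzsc, hzsle⟩ := exists_pos_le_of_tendsto (fun n => div_pos (hZpos' n) (pow_pos hlam n))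
    (by positivity) hzt
  have hz : ∀ n, zs * lam ^ n ≤ ⟪b, (A ^ n) b⟫ := fun n =>
    (le_div_iff₀ (pow_pos hlam n)).1 (hzsle n)
  -- ### the covariance bounds
  set e1 : ℕ → ℕ → ℝ := fun n l => ⟪(A ^ l) b, H₁ ((A ^ (n - 1 - l)) b)⟫ / ⟪b, (A ^ n) b⟫ with he1
  set e2 : ℕ → ℕ → ℕ → ℝ := fun n l m =>
    if l < m then ⟪(A ^ l) b, H₁ ((A ^ (m - l - 1)) (H₁ ((A ^ (n - 1 - m)) b)))⟫ / ⟪b, (A ^ n) b⟫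
    else if m < l then ⟪(A ^ m) b, H₁ ((A ^ (l - m - 1)) (H₁ ((A ^ (n - 1 - l)) b)))⟫ / ⟪b, (A ^ n) b⟫
    else ⟪(A ^ l) b, H₂ ((A ^ (n - 1 - l)) b)⟫ / ⟪b, (A ^ n) b⟫ with he2
  set Cf : ℕ → ℝ := fun d => if d = 0 then ⟪φ, H₂ φ⟫ / lam - (⟪φ, H₁ φ⟫ / lam) ^ 2 else
      ⟪H₁ φ, (A ^ (d - 1)) (H₁ φ)⟫ / lam ^ (d + 1) - (⟪φ, H₁ φ⟫ / lam) ^ 2 with hCf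
  obtain ⟨C₁, C₂, C₃, r, hr0, hr1, H1, H2, H3⟩ := exists_covariance_bounds (A := A) (H₁ := H₁)
    (H₂ := H₂) (φ := φ) (b := b) (lam := lam) (θ := θ) (zs := zs) hsymA hsymH hφ1 hAφ hlam hθ0 hθ
    hpow hzs0 hz hzsc e1 (fun _ _ _ => rfl) e2
    (fun n l m hlm _ => by rw [he2]; dsimp only; rw [if_pos hlm])
    (fun n l m => by
      rw [he2]; dsimp only
      rcases lt_trichotomy l m with hlm | rfl | hml
      · rw [if_pos hlm, if_neg (not_lt.2 hlm.le), if_pos hlm]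
      · rfl
      · rw [if_neg (not_lt.2 hml.le), if_pos hml, if_pos hml])
    (fun n l _ => by rw [he2]; dsimp only; rw [if_neg (lt_irrefl _), if_neg (lt_irrefl _)])
    Cf (by rw [hCf]; dsimp only; rw [if_pos rfl]) (fun d hd => by rw [hCf]; dsimp only; rw [if_neg hd.ne'])
  have hces := tendsto_sum_sum_div hr0 hr1 H1 H2 H3
  set σ2 : ℝ := Cf 0 + 2 * ∑' d, Cf (d + 1) with hσ2
  set CS : ℕ → ℝ := fun n => ∑ l ∈ Finset.range n, ∑ m ∈ Finset.range n, (e2 n l m - e1 n l * e1 n m)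
    with hCS
  set KR : ℝ := 2 * ‖b‖ * ‖bU‖ / zs with hKR
  -- ### per `n`: the variance of `Φ_{n+1}` versus the covariance double sum
  have hmain : ∀ n : ℕ,
      |Var[P.potential (n + 1); (ENNReal.ofReal (∫ q : Fin (n + 1) → ℝ,
          Real.exp (-P.potential (n + 1) q / T)))⁻¹ • volume.withDensity fun q =>
            ENNReal.ofReal (Real.exp (-P.potential (n + 1) q / T))] - CS n| ≤
        KR + 2 * Real.sqrt (CS n * KR) ∧ 0 ≤ CS n := by
    intro n
    obtain ⟨hnn, -, hbd⟩ := abs_variance_potential_sub_sum_cov_le (P := P) (n := n) hT hU0 hV0 hUc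
      hVc ha hint hh rfl
    obtain ⟨hsum, hKRn⟩ := sum_cov_eq_sum_range (P := P) (n := n) hT hU0 hV0 hUc hVc ha hint hab hk hh
      hρ hkc.measurable hkbC hkhm hkhbC hkh2m hkh2bC hA hsymA hH₁ hH₂ hb hUabC hbU rfl e1
      (fun _ => rfl) e2 (fun l m hlm => by rw [he2]; dsimp only; rw [if_pos hlm])
      (fun l m => by
        rw [he2]; dsimp only
        rcases lt_trichotomy l m with hlm | rfl | hml
        · rw [if_pos hlm, if_neg (not_lt.2 hlm.le), if_pos hlm]
        · rfl
        · rw [if_neg (not_lt.2 hml.le), if_pos hml, if_pos hml])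
      (fun l => by rw [he2]; dsimp only; rw [if_neg (lt_irrefl _), if_neg (lt_irrefl _)])
    have hKRle : (⟪bU, (A ^ n) b⟫ + ⟪b, (A ^ n) bU⟫) / (2 * ⟪b, (A ^ n) b⟫) ≤ KR :=
      boundary_ratio_le hsymA hφ1 hlam hθ0 hθ.le hpow hzs0 hz bU n
    rw [hsum] at hbd hnn
    rw [hKRn] at hbd
    refine ⟨hbd.trans ?_, hnn⟩
    have hKR0 : 0 ≤ KR := by positivity
    gcongr
  exact ⟨σ2, (tendsto_div_succ_of_abs_sub_le (fun n => (hmain n).2) (fun n => (hmain n).1) hces).1,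
    (tendsto_div_succ_of_abs_sub_le (fun n => (hmain n).2) (fun n => (hmain n).1) hces).2⟩

/-- **The kinetic energy of `L` i.i.d. `𝒩(0, T)` momenta has variance `L T²/2`**
(`Var(p²/2) = (3T² - T²)/4`). [folklore] -/
theorem variance_kinetic_pi_gaussian {T : ℝ} (hT : 0 < T) (L : ℕ) :
    Var[fun p : Fin L → ℝ => ∑ i, p i ^ 2 / 2; Measure.pi fun _ : Fin L => gaussianReal 0 T.toNNReal] =
      L * (T ^ 2 / 2) := by
  have hv : ((T.toNNReal : ℝ≥0) : ℝ) = T := Real.coe_toNNReal T hT.le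
  have hX : MemLp (fun s : ℝ => s ^ 2 / 2) 2 (gaussianReal 0 T.toNNReal) := by
    rw [memLp_two_iff_integrable_sq (by fun_prop)]
    have := (integrable_pow_gaussianReal 0 T.toNNReal 4).div_const 4
    refine this.congr (ae_of_all _ fun s => ?_)
    dsimp only
    ring
  have hvar1 : Var[fun s : ℝ => s ^ 2 / 2; gaussianReal 0 T.toNNReal] = T ^ 2 / 2 := by
    rw [variance_eq_sub hX]
    have h4 : ∫ s, ((fun s : ℝ => s ^ 2 / 2) ^ 2) s ∂(gaussianReal 0 T.toNNReal) = 3 * T ^ 2 / 4 := by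
      have e : ((fun s : ℝ => s ^ 2 / 2) ^ 2) = fun s : ℝ => (1 / 4 : ℝ) * s ^ (2 * 2) := by
        funext s; simp only [Pi.pow_apply]; ring
      rw [e, integral_const_mul, integral_pow_even_gaussianReal, hv]
      norm_num [Nat.doubleFactorial]
      ring
    have h2 : ∫ s, (fun s : ℝ => s ^ 2 / 2) s ∂(gaussianReal 0 T.toNNReal) = T / 2 := by
      have e : (fun s : ℝ => s ^ 2 / 2) = fun s : ℝ => (1 / 2 : ℝ) * s ^ (2 * 1) := by
        funext s; ring
      rw [e, integral_const_mul, integral_pow_even_gaussianReal, hv]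
      norm_num [Nat.doubleFactorial]
      ring
    rw [h4, h2]
    ring
  have e : (fun p : Fin L → ℝ => ∑ i, p i ^ 2 / 2) =
      ∑ i : Fin L, fun p : Fin L → ℝ => (fun s : ℝ => s ^ 2 / 2) (p i) := by
    funext p; simp only [Finset.sum_apply]
  rw [e, variance_sum_pi (fun _ => hX), Finset.sum_const, Finset.card_univ, Fintype.card_fin,
    nsmul_eq_mul, hvar1]

/-- **Equipartition of the energy fluctuations.** For the pinned anharmonic chain (`ω₂ > 0`,
`lam, β ≥ 0`) at `T > 0`: `∫ (H_N - ⟨H_N⟩)² dμ_N = N T²/2 + Var_{ν_N}(Φ_N)` (`N = n + 1`), `ν_N` the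
configurational Gibbs probability measure `Z⁻¹ e^{-Φ_N/T} dq`. [folklore] -/
theorem integral_sq_sub_hamiltonian_eq {ω₂ lam β : ℝ} (hω : 0 < ω₂) (hl : 0 ≤ lam) (hβ : 0 ≤ β)
    (γ : ℝ) {T : ℝ} (hT : 0 < T) (n : ℕ) :
    ∫ x, ((pinnedChain ω₂ lam β γ).hamiltonian (n + 1) x -
        ∫ y, (pinnedChain ω₂ lam β γ).hamiltonian (n + 1) y
          ∂((pinnedChain ω₂ lam β γ).gibbsMeasure (n + 1) T)) ^ 2
        ∂((pinnedChain ω₂ lam β γ).gibbsMeasure (n + 1) T) =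
      ((n : ℝ) + 1) * (T ^ 2 / 2) + Var[(pinnedChain ω₂ lam β γ).potential (n + 1);
        (ENNReal.ofReal (∫ q : Fin (n + 1) → ℝ,
            Real.exp (-(pinnedChain ω₂ lam β γ).potential (n + 1) q / T)))⁻¹ •
          volume.withDensity fun q =>
            ENNReal.ofReal (Real.exp (-(pinnedChain ω₂ lam β γ).potential (n + 1) q / T))] := by
  set P := pinnedChain ω₂ lam β γ with hP
  have hUc : Continuous P.U := pinnedChain_continuous_U γ
  have hVc : Continuous P.V := pinnedChain_continuous_V γ
  have hprod := gibbsMeasure_eq_prod P hUc hVc hT (pinnedChain_integrable_configWeight hω hl hβ γ (n + 1) hT)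
  have hHm : AEMeasurable (P.hamiltonian (n + 1)) (P.gibbsMeasure (n + 1) T) :=
    (P.continuous_hamiltonian hUc hVc (n + 1)).measurable.aemeasurable
  rw [← variance_eq_integral hHm]
  have hH : P.hamiltonian (n + 1) = fun x : PhaseSpace (n + 1) =>
      P.potential (n + 1) x.1 + (fun p : Fin (n + 1) → ℝ => ∑ i, p i ^ 2 / 2) x.2 := by
    funext x; rw [P.hamiltonian_eq_kinetic_add_potential]; ring
  -- `L²` memberships
  have ha : ∀ x, (fun x => Real.exp (-P.U x / (4 * T))) x = Real.exp (-P.U x / (4 * T)) := fun x => rfl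
  have hU0 : ∀ x, 0 ≤ P.U x := pinnedChain_U_nonneg hω.le hl γ
  have hV0 : ∀ r, 0 ≤ P.V r := pinnedChain_V_nonneg hβ γ
  have hint := integrable_siteWeight_sq (β := β) (γ := γ) hω hl hT ha
  haveI : IsProbabilityMeasure ((ENNReal.ofReal (∫ q : Fin (n + 1) → ℝ,
      Real.exp (-P.potential (n + 1) q / T)))⁻¹ • volume.withDensity fun q =>
        ENNReal.ofReal (Real.exp (-P.potential (n + 1) q / T))) :=
    (confMeasure_spec (P := P) (n := n) hT hU0 hV0 hUc hVc ha hint rfl).1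
  have hΦm : MemLp (P.potential (n + 1)) 2 ((ENNReal.ofReal (∫ q : Fin (n + 1) → ℝ,
      Real.exp (-P.potential (n + 1) q / T)))⁻¹ • volume.withDensity fun q =>
        ENNReal.ofReal (Real.exp (-P.potential (n + 1) q / T))) := by
    refine memLp_confMeasure_of_le (P := P) (n := n) hT hU0 hV0 hUc hVc ha hint rfl
      (continuous_potential_succ hUc hVc n) (C := 1) fun q => ?_
    have h0 : 0 ≤ P.potential (n + 1) q := by
      rw [potential_succ_eq]
      exact add_nonneg (Finset.sum_nonneg fun i _ => hU0 _) (Finset.sum_nonneg fun i _ => hV0 _)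
    rw [abs_of_nonneg h0]; linarith
  have hX : MemLp (fun s : ℝ => s ^ 2 / 2) 2 (gaussianReal 0 T.toNNReal) := by
    rw [memLp_two_iff_integrable_sq (by fun_prop)]
    have := (integrable_pow_gaussianReal 0 T.toNNReal 4).div_const 4
    refine this.congr (ae_of_all _ fun s => ?_)
    dsimp only
    ring
  have hKm : MemLp (fun p : Fin (n + 1) → ℝ => ∑ i, p i ^ 2 / 2) 2
      (Measure.pi fun _ : Fin (n + 1) => gaussianReal 0 T.toNNReal) := by
    have := memLp_finsetSum (s := Finset.univ)
      (fun i (_ : i ∈ Finset.univ) => hX.comp_measurePreserving (measurePreserving_eval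
        (fun _ : Fin (n + 1) => gaussianReal 0 T.toNNReal) i))
    simpa [Function.comp_def] using this
  rw [hH, hprod, variance_add_prod hΦm hKm, variance_kinetic_pi_gaussian hT (n + 1)]
  push_cast
  ring

end SpecificHeatLimit

open SpecificHeatLimit

/-- **`SpecificHeatLimit` (item `stmt-AtomisticToContinuum-12398`).** For the pinned anharmonic chain
`pinnedChain ω₂ lam β γ` (all parameters `> 0`) and every `T > 0` the specific heat per site exists and
is positive: `Var_{μ_N}(H_N)/(N T²) → c_v` with `c_v = 1/2 + σ²/T² ≥ 1/2`, where `σ² ≥ 0` is the limit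
of the configurational energy variance per site (transfer operator: Jentzsch / Kreĭn–Rutman gap,
exponential clustering, Cesàro) and `1/2` the equipartition contribution of the Gaussian momenta.
[folklore] -/
theorem specificHeatLimit_proof :
    Summit.AtomisticToContinuum.FouriersLaw.Theses.HeatModeWeylLaw.SpecificHeatLimit := by
  intro ω₂ lam β γ hω hl hβ _hγ T hT
  show ∃ cv : ℝ, 0 < cv ∧ Tendsto (fun N : ℕ => (∫ x, ((pinnedChain ω₂ lam β γ).hamiltonian N x -
      ∫ y, (pinnedChain ω₂ lam β γ).hamiltonian N y ∂((pinnedChain ω₂ lam β γ).gibbsMeasure N T)) ^ 2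
        ∂((pinnedChain ω₂ lam β γ).gibbsMeasure N T)) / ((N : ℝ) * T ^ 2)) atTop
      (𝓝 cv)
  obtain ⟨σ2, hσ2, hconv⟩ := confVariance_div_tendsto hω hl.le hβ.le γ hT
  refine ⟨1 / 2 + σ2 / T ^ 2, by positivity, ?_⟩
  rw [← tendsto_add_atTop_iff_nat 1]
  have hpt : ∀ n : ℕ, (∫ x, ((pinnedChain ω₂ lam β γ).hamiltonian (n + 1) x -
      ∫ y, (pinnedChain ω₂ lam β γ).hamiltonian (n + 1) y
        ∂((pinnedChain ω₂ lam β γ).gibbsMeasure (n + 1) T)) ^ 2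
        ∂((pinnedChain ω₂ lam β γ).gibbsMeasure (n + 1) T)) / (((n + 1 : ℕ) : ℝ) * T ^ 2) =
      1 / 2 + (Var[(pinnedChain ω₂ lam β γ).potential (n + 1);
        (ENNReal.ofReal (∫ q : Fin (n + 1) → ℝ,
            Real.exp (-(pinnedChain ω₂ lam β γ).potential (n + 1) q / T)))⁻¹ •
          volume.withDensity fun q =>
            ENNReal.ofReal (Real.exp (-(pinnedChain ω₂ lam β γ).potential (n + 1) q / T))] /
        ((n : ℝ) + 1)) / T ^ 2 := by
    intro n
    rw [integral_sq_sub_hamiltonian_eq hω hl.le hβ.le γ hT n]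
    push_cast
    field_simp
  simp_rw [hpt]
  exact tendsto_const_nhds.add (hconv.div_const _)

end Summit.AtomisticToContinuum.FouriersLaw.Theorems

end
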